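import Summits.NavierStokesRegularity.NavierStokesRegularity.Theorems.ScenarioCensusSteadyS2s
import Summits.NavierStokesRegularity.NavierStokesRegularity.Theorems.ScenarioCensusSteadyRegularity
import HarnessLib

/-!
# Blow-up scenario census, block S: row S2 (Korobkov–Pileckas–Russo 2015, steady axisymmetric no-swirl Liouville)
# is EXCLUDED-IN-TREE (leaf closer)

Cell `pub/ns-census`, typer seat `ns-census-typer-1` (generation 5; prover work announced 15:58Z / 16:03Z).  Census row
S2 (`ScenarioCensusSteady.lean`: `Row_S2 := FP.KorobkovPileckasRusso2015_liouville_noSwirl` — steady · axisymmetric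
WITHOUT swirl · `D`-solutions with `U → 0` at infinity, any `ν > 0`, `U ∈ C²`, `P ∈ C¹` ⇒ `U = 0`; Korobkov–Pileckas–Russo,
JMFM 17 (2015) Thm 1.1, and its Addendum JMFM 18 (2016) 207: «follows from [KNSS 2009]») is closed BY NAME by composing
* the smooth sub-cell S2s (`row_S2s_excluded`, `row_S2_of_row_S2s_of_regularity`; `ScenarioCensusSteadyS2s`), and
* the steady regularity `SteadyRegularity.contDiff_of_isLerayProfile_zero_of_tendsto` (`ScenarioCensusSteadyRegularity`:
  a `C²`/`C¹` steady solution with bounded velocity is smooth, through KNSS 2009 §4 regularity of bounded weak ancient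
  solutions, PROVED in the tree).
This leaf only composes the two (kept out of both so that neither the decl file nor the tool file imports the other).

No summit statement is proved; nothing here is a claim about the forward regularity problem.
-/

-- the summit and its single problem share the name (D-0017 nested layout)
set_option linter.dupNamespace false

noncomputable section

namespace Summit.NavierStokesRegularity.NavierStokesRegularity.Theorems.ScenarioCensus

/-- **Census row S2 is EXCLUDED-IN-TREE**: Korobkov–Pileckas–Russo 2015, Thm 1.1 — for every `ν > 0`, a `C²`/`C¹` steady
Navier–Stokes solution on `ℝ³` (Leray profile at rate `0`), axisymmetric without swirl, with finite Dirichlet integral and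
`U → 0` at infinity, vanishes — i.e. `Row_S2` (`= Literature.Analysis.FluidPDE.KorobkovPileckasRusso2015_liouville_noSwirl`,
the named fact, now a theorem of the tree): steady regularity (`SteadyRegularity.contDiff_of_isLerayProfile_zero_of_tendsto`)
+ the smooth sub-cell (`row_S2_of_row_S2s_of_regularity`, i.e. viscosity normalisation, steady ⇒ bounded ancient mild class,
KNSS 2009 Thm 5.2 with decay). -/
theorem row_S2_excluded : Row_S2 :=
  row_S2_of_row_S2s_of_regularity fun _ν hν _U _P hprof h0 =>
    SteadyRegularity.contDiff_of_isLerayProfile_zero_of_tendsto hν hprof h0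

/-- The Literature fact `KorobkovPileckasRusso2015_liouville_noSwirl` holds (same term; recorded under the fact's own
name for by-name citation — the fact itself lives in `Literature/` and cannot import this Summits-side chain). -/
theorem korobkovPileckasRusso2015_liouville_noSwirl_holds :
    Literature.Analysis.FluidPDE.KorobkovPileckasRusso2015_liouville_noSwirl :=
  row_S2_excluded

end Summit.NavierStokesRegularity.NavierStokesRegularity.Theorems.ScenarioCensus

end
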